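import Mathlib
import HarnessLib
import HarnessLib.Audit
import Summits.AtomisticToContinuum.Statement
import Literature.MathematicalPhysics.QuantumManyBody.PeriodicBoseGas
import Literature.MathematicalPhysics.QuantumManyBody.BoseGasStructureFactor
import Summits.AtomisticToContinuum.BoseEinsteinCondensation.Theorems.BECGroundStateSOSPeriodicEnergyFinite
import Summits.AtomisticToContinuum.BoseEinsteinCondensation.Theorems.BECFisherTransferPeriodicOccupationStability
import Summits.AtomisticToContinuum.BoseEinsteinCondensation.Theorems.BECMeanFieldControlLandscapeToCondensate
import HarnessLib.Audit.Status.Attr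

/-!
Route: BECCountConvexity

# Route BECCountConvexity — Gaussian domination of the coarse count law by convexity —
count-exchange flatness (IR, count law only) plus local placement give the flat teleportation
landscape on the torus, hence BEC

It suffices to show X = TypicalLandscape (the shared hinge stmt-AtomisticToContinuum-8701 of route
BECMeanFieldControl, re-asked verbatim as
the rank-0 target): for every repulsive finite-range v, at all small ρ, some C, all large n and
EVERY δ > 0 there is a nonnegative periodic
δ-near-minimiser Ψ of N = n+1 bosons on the torus of side L = (N/ρ)^(1/3) whose teleportation
landscape is flat in probability — relocating a
typical boson to a uniform point y costs ≤ C in log-amplitude off an exceptional set of (Ψ²dX ⊗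
dy)-mass ≤ L³/2. This route (card
log-concave-counts-brascamp-lieb, gen-2 of the retired Dirichlet route BECLogConcaveCounts) realises
X by an EXACT factorisation of the
teleportation ratio through the coarse cell-count vector n(X) (cubes of side ≈ ℓ, fixed as N → ∞):
Ψ(X')²/Ψ(X)² = [P̂(n(X'))/P̂(n(X))] ·
[conditional density given the counts at X' vs X], P̂ = law of n under Ψ². X ⟸ X₁ ∧ X₂ with X₁ =
CountExchangeFlat (the first factor is ≥ κ₁
in probability: a statement about the COUNT LAW ONLY under a one-particle transfer between two cells
a distance ~L apart — the infrared half,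
whose engine is Gaussian domination of P̂ by convexity: fibre log-concavity + the kinetic structure
floor) and X₂ = LocalPlacementFlat (the
second factor is ≥ κ₂ in probability at SOME coarse scale — a fixed-scale dilute-gas insertion
statement). Downstream X → BEC is the certified
shared chain PeriodicRigidity → LandscapeToCondensate → PeriodicOccupationStability →
BoundaryTransferWeak (closes adapted from BECMeanFieldControl).
Lean: `CountExchangeFlat ∧ LocalPlacementFlat`

## Assembly
The deciding theorem `closes (hCE : CountExchangeFlat) (hLP : LocalPlacementFlat) (hP :
PositivePeriodicNearMinimiser) (hF : PeriodicEnergyFinite)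
(hS : CountLocalSplit) (h₂ : PeriodicRigidity) (h₃ : LandscapeToCondensate) (h₄ :
PeriodicOccupationStability) (h₅ : BoundaryTransferWeak) :
_root_.BoseEinsteinCondensation` elaborates sorry-free in SketchGlue.lean (axioms
propext/Classical.choice/Quot.sound): `hS hCE hLP hP hF :
TypicalLandscape`, then verbatim the certified 80-line chain of BECMeanFieldControl — ρ₀ = min, c =
e^(−C)/32, eventually in N = n+1, rigidity at
η = e^(−C)/8 fixes δ, the landscape witness Ψ at this δ has condensateOccupation ≥ (n+1)e^(−C)/2
(LandscapeToCondensate), a δ-near-minimiser Φ is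
e^(−C)/8-close up to phase, PeriodicOccupationStability gives √occ(Φ) ≥ √((n+1)e^(−C)/2) −
√((n+1)e^(−C)/8), i.e. occ(Φ) ≥ (n+1)e^(−C)/32, and
BoundaryTransferWeak carries the torus zero mode to HasGroundStateBEC. Standard reductions only
(ENNReal rpow bookkeeping).

Rationale: WHY THIS LINE. For a positive wave function ODLRO is the statement that teleporting one particle to
a uniformly random point costs O(1) in log Ψ² with positive
probability (PenroseOnsager1956 §6 free-volume estimate; Reatto1969; McMillan1965's ratio
estimator); TypicalLandscape → BEC is rigorous by Markov
(LandscapeToCondensate, provable now). The new move is to split that cost EXACTLY through the coarse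
count law P̂ on ℤ^(cells): the long-wavelength
physics (ReattoChester1967 1/r² tail, phonons, hyperuniformity S(k) ≍ k: TorquatoStillinger2003)
then lives in a probability statement about a pmf,
where Gaussian domination comes from CONVEXITY instead of reflection positivity
(BrascampLiebLebowitz1975, BrascampLieb1976, SpencerZirnbauer2004,
doi:10.1007/s00220-010-1117-5): along a transfer line d = e_c − e_c' the cost Δ_dU, U = −log P̂,
obeys the exact normalisation E e^(−Δ_dU) = 1 (the
card's Ward identity) and the Jeffreys identity J_d = E[Δ_dU(1 − e^(−Δ_dU))], so P(Δ_dU > t) ≤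
J_d/(t(1−e^(−t))); at the Gaussian level J_d =
dᵀC⁻¹d ≤ (C₀/4π³ρ)∫(1−cos k·r)/S(k) d³k, and the ELEMENTARY kinetic structure floor S(k) ≥
k²/(2√t+k)² (t = kinetic energy per particle ≲ 4πρa;
commutator [ρ_k, Σe^(ik·x_j)k̂·∇_j] = i|k|N plus Cauchy–Schwarz, in the spirit of
PitaevskiiStringari1991/Stringari1995/Wagner1966) already makes
this ≤ C₀[16a/ℓ + √2/(ρξℓ²) + π/(3ρℓ³)] uniformly in N and in the transfer distance r in d = 3 (no
Landau/linear-phonon assumption; d = 2 would need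
Puff1965's m₃ floor, d = 1 diverges as it must: Lenard1964). What is genuinely at stake is therefore
UNIT-SCALE REGULARITY of P̂ along transfer
lines (Cramér–Rao only gives E[Hess U] ≥ C⁻¹): that is where log-concavity enters — monotone fibre
ratios plus a fibre variance floor (no number
rigidity in d = 3: GhoshLebowitz2017, GhoshPeres2017) give the ratio bound with mass defect
O(1/((1−κ)σ_fibre)). Imported areas: convex-measure
probability (log-concavity, Fisher/Jeffreys identities), point-process statistics (hyperuniformity,
rigidity, Widom1963 insertion), sum rules. Versus
the tree: the other landscape routes attack TypicalLandscape / LandscapeBound by mean-field control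
(BECMeanFieldControl), two-replica FK transience
(BECCutLineWeakDisorder), Riesz/Jastrow shadows (BECRieszShadow), anti-bunching Palm means
(BECLiebAntibunching); none factors through the count
law, and no open route uses convexity of a LAW (BECSectorPoincareTwoScale convexifies the energy;
BECStronglyRayleigh uses Pólya–Schur). Gen-1
(BECLogConcaveCounts, retired not-a-thesis 2026-08-15) was Dirichlet-native with its own positivity
bridge; gen-2 moves to the torus, where P̂ is
translation-invariant and the downstream chain is shared and certified. Negatives index: only
BECSwapAffinity.SwapJensen (misstated constant), not used.

RANKED CRUXES. #0 TypicalLandscape (target) — verbatim stmt-AtomisticToContinuum-8701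
(BECMeanFieldControl): ∀ admissible v ∃ρ₀ ∀ρ<ρ₀ ∃C ∀ᶠn ∀δ>0 ∃ periodic δ-near-minimiser Ψ ≥ 0 of n+1
bosons on the torus of side L = ((n+1)/ρ)^(1/3) with ∫_(cell^n)∫_cell Ψ(x,Y)²·vol{y ∈ cell : Ψ(y,Y)
< e^(−C)Ψ(x,Y)} dx dY ≤ L³/2. Here reached as CountExchangeFlat ∧ LocalPlacementFlat ∧
PositivePeriodicNearMinimiser ∧ PeriodicEnergyFinite (CountLocalSplit). (why it might fail:
conjecture-strength: the one-atom increment of log Ψ₀ carries the collective 1/r² tail (a û~1/k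
linear statistic); O(1) only if the bath decorrelates; in d=1 the spread grows like ½·log L
(Girardeau), and nothing proved excludes slow growth in d=3.) [PenroseOnsager1956,
ReattoChester1967, McMillan1965, LSSY2005]
#2 CountExchangeFlat (crux) — COUNT-EXCHANGE FLATNESS (card items LC + IR merged into their
consequence; torus). Tile [0,L)³ into M³ cubes, M = ⌊L/ℓ⌋, n(X) = cell-count vector, P̂(m) =
Ψ²-probability of {n = m} on the fundamental cell. ∀η>0 ∃ρ₀(η) ∀ρ<ρ₀ ∃κ>0 ∃ℓ₀ ∀ℓ≥ℓ₀ ∀ᶠn ∃δ>0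
(tolerance before density: at low enough density for each η), for EVERY periodic δ-near-minimiser Ψ
of n+1 bosons (complex allowed; depends on Ψ only through P̂): the pairs (x::Y, y) with P̂(n(y::Y))
< κ·P̂(n(x::Y)) — one particle moved from the cell of x to the cell of y, typically ~L apart — or
with P̂(n(x::Y)) = 0, have (Ψ²dxdY ⊗ dy)-mass ≤ ηL³. Engine: Jeffreys identity + Gaussian-level
bound J_d ≤ C₀[16a/ℓ + √2/(ρξℓ²) + π/(3ρℓ³)] from KineticStructureFloor; unit-scale regularity from
FibreLogConcaveCounts + a fibre variance floor. v ≡ 0: multinomial counts, ratio n_c₁/(n_c+1), bad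
mass e^(−cρℓ³)L³ — holds. [deps: FibreLogConcaveCounts, KineticStructureFloor] [difficulty:
open-problem] (why it might fail: only the Gaussian-level precision is cheap (Cramér–Rao: E[Hess U]
≥ C⁻¹); unit-scale fine structure of P̂ (parity/jamming) or number rigidity at scale ℓ (possible in
d ≥ 3: Peres–Sly perturbed lattices, arXiv:1601.04216 §4) would give J_d ≫ dᵀC⁻¹d.)
[BrascampLiebLebowitz1975, SpencerZirnbauer2004, TorquatoStillinger2003, GhoshLebowitz2017,
arXiv:1601.04216, arXiv:1409.4490, arXiv:2007.11030, PitaevskiiStringari1991, Lenard1964]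
#3 LocalPlacementFlat (crux) — LOCAL PLACEMENT FLATNESS (card item LINK; torus): with the same
cells, the complementary factor — the conditional density of the configuration given its count
vector, [Ψ(y::Y)²/P̂(n(y::Y))]/[Ψ(x::Y)²/P̂(n(x::Y))], cross-multiplied — is ≥ κ off mass ≤ ηL³, at
SOME scale ℓ ≥ ℓ₀ for every ℓ₀ (∀η ∃ρ₀(η) ∀ρ<ρ₀ ∀ℓ₀ ∃ℓ≥ℓ₀ ∃κ ∀ᶠn ∃δ ∀ near-minimisers; η before ρ₀
because for hard cores the excluded volume (4π/3)ρa³·L³, where Ψ(y::Y) = 0, is always exceptional):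
a fixed-scale statement uniform in N. Engine: dilute-gas insertion inside a cell (Widom /
Penrose–Onsager free volume; the local Jastrow exponent Σ_j u(x−x_j) has x-independent mean and
variance O(√(ρa³)) at low density) and screening of the 1/r² tail by the conditioning on counts. v ≡
0: ratio (n_c+1)/n_c₁ ≈ 1 — tight. Logically X₂ = X − X₁ given P̂ > 0 a.e., so it is no harder than
X once X₁ holds; its content is that it should be provable by fixed-scale means. [deps:
CountExchangeFlat] [difficulty: XL] (why it might fail: conditioning on SHARP cell counts may not
screen the Reatto–Chester 1/r² tail or three-body terms, leaving an L-dependent one-body drift in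
the residual; then smoothed/two-scale counts are needed — a wrong-split failure, repairable by
restating.) [Widom1963, PenroseOnsager1956, ReattoChester1967, Reatto1969, Fournais2020]
#4 PeriodicRigidity (crux) — verbatim stmt-AtomisticToContinuum-8958 (shared with
BECMeanFieldControl, BECRieszShadow, BECLiebAntibunching): ∀ admissible v ∃ρ₀ ∀ρ<ρ₀ ∀ᶠN ∀η>0 ∃δ>0:
any two periodic δ-near-minimisers Ψ, Φ of N bosons on the torus of side (N/ρ)^(1/3) satisfy
∫_(cell^N)|Ψ − cΦ|² ≤ η for some unit complex c (E₀^per < ∞ at low density, compact resolvent,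
unique positive ground state by positivity improvement, spectral gap at fixed N). [difficulty: M]
(why it might fail: routine for bounded v (Perron–Frobenius), but v may be ⊤-valued (hard cores,
shells ⊤·1_[a,b]): {V<∞} may disconnect and uniqueness needs the dilute component to be the unique
minimiser at every large N — open (BaryshnikovBubenikKahle2013, DiaconisLebeauMichel2010).)
[ReedSimonIV1978, BaryshnikovBubenikKahle2013, DiaconisLebeauMichel2010, LSSY2005]
#5 BoundaryTransferWeak (crux) — verbatim stmt-AtomisticToContinuum-0827 (shared by ≥ 10 routes):
for each repulsive finite-range v, torus zero-mode condensation of all δ(N)-near-minimisers at small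
ρ implies ∃ρ₀ ∀ρ<ρ₀ HasGroundStateBEC v ρ (Dirichlet ground state, λ_max ≥ cN via condensateNumber).
Expected proof: Neumann bracketing of interior sub-boxes + a mode-free criterion; only the ENERGY
analogue is in print (LSSY2005 Ch. 2 after (2.8)). [difficulty: L] (why it might fail: hypothesis is
ground-state-only (δ after N) at box (N/ρ)^(1/3): the Dirichlet state restricted to sub-boxes is
neither periodic nor a near-minimiser, so the transfer may be as hard as the conjunct; free-gas BEC
is BC-sensitive (Robinson1976).) [LSSY2005, Robinson1976, Basti2022, BoccatoSeiringer2023,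
Junge2026, LauwersVerbeureZagrebnov2003]
#9 CountLocalSplit (support) — GLUE of the split (provable now): CountExchangeFlat →
LocalPlacementFlat → PositivePeriodicNearMinimiser → PeriodicEnergyFinite → TypicalLandscape (the
two support hypotheses are inlined verbatim in the Lean term so the decl is independent of the
gate's rendering order). Pointwise in y: off bad_CE ∪ bad_LP one has κ₁P̂(n) ≤ P̂(n′), 0 < P̂(n) ≤ 1
and κ₂Ψ²P̂(n′) ≤ Ψ′²P̂(n), hence κ₁κ₂Ψ(x::Y)² ≤ Ψ(y::Y)² (ENNReal.mul_le_mul_right), i.e. y ∉ bad_T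
with e^(−C) = √(κ₁κ₂); volumes are monotone and subadditive, the weights Ψ(x::Y)² integrate by
lintegral_add_left once (x,Y) ↦ vol(bad_CE) is shown measurable (cnt takes countably many values on
measurable boxes); quantifiers: η = 1/4 twice (fixing ρ₀^CE, ρ₀^LP), ρ₀ = min(ρ₀^CE, ρ₀^LP, ρ₀^F),
κ₁ and ℓ₀ from CE, ℓ ≥ ℓ₀ and κ₂ from LP, CE at that ℓ, C = −log(κ₁κ₂)/2, eventual ranges
intersected (shift N = n+1), δ′ = min(δ, δ_CE, δ_LP) and the witness from
PositivePeriodicNearMinimiser (E₀^per ≠ ⊤ by PeriodicEnergyFinite). [difficulty: provable-now]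
[LSSY2005, PenroseOnsager1956]
#9 PositivePeriodicNearMinimiser (support) — periodic twin of
BECRieszLandscape.PositiveNearMinimiserExists: whenever E₀^per(N, L) < ⊤, for every δ > 0 there is a
δ-near-minimiser Φ ∈ PeriodicTrialState N L with Φ = ‖Φ‖ pointwise. Construction without mollifiers:
from a δ/2-near-minimiser Ψ put Φ_ε := (√(|Ψ|² + ε²) − ε)/‖·‖₂ — C¹ (|Ψ|² is C¹, t ↦ √(t+ε²)
smooth), periodic, symmetric, vanishes exactly where Ψ does (cores: ⊤·0 = 0), |∇Φ_ε| ≤ |∇Ψ|/‖·‖ and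
Φ_ε ≤ |Ψ|/‖·‖ pointwise, ‖√(|Ψ|²+ε²) − ε‖₂ → 1; so periodicEnergy Φ_ε ≤ E₀ + δ for small ε. N = 0:
the constant state. [difficulty: provable-now] [LSSY2005, ReedSimonIV1978]
#9 PeriodicEnergyFinite (support) — verbatim stmt-AtomisticToContinuum-3974 (shared with
BECGroundStateSOS, BECRewardWalk): for repulsive finite-range v (range R₀) there is ρ₀ > 0 with
E₀^per(N, (N/ρ)^(1/3)) < ⊤ for ρ < ρ₀ and all large N (N bumps at mutual torus distance > R₀,
symmetrised; or LSSY2005_upperBound_periodic once scatteringLength v ≠ ⊤). [difficulty: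
provable-now] [LSSY2005]
#9 LandscapeToCondensate (support) — verbatim stmt-AtomisticToContinuum-8703 (shared with
BECMeanFieldControl; provable now): for L > 0, any real C and any periodic Ψ ≥ 0 of n+1 bosons on
the torus of side L, if ∫_(cell^n)∫_cell Ψ(x,Y)²·vol{y ∈ cell : Ψ(y,Y) < e^(−C)Ψ(x,Y)} ≤ L³/2 then
condensateOccupation ≥ (n+1)e^(−C)/2 (occ₀ = (n+1)L⁻³∫s(Y)², s = ∫_cell Ψ(·,Y); s² ≥
e^(−C)∫Ψ(x,Y)²·vol(good_(x,Y)); ∫∫Ψ² = 1 via the measure-preserving split X = x :: Y). [difficulty: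
provable-now] [PenroseOnsager1956, LSSY2005]
#9 PeriodicOccupationStability (support) — verbatim stmt-AtomisticToContinuum-9164 (shared; provable
now): for periodic trial states Ψ, Φ of N bosons and |c| = 1, condensateOccupation(Ψ)^(1/2) ≤
condensateOccupation(Φ)^(1/2) + N^(1/2)(∫_(cell^N)|Ψ − cΦ|²)^(1/2) (Minkowski in L²(cell^(N−1));
occ(cΦ) = occ(Φ)). [difficulty: provable-now] [LSSY2005]
#9 FibreLogConcaveCounts (support) — the card's headline conjecture LC in BULK fibre form (engine of
CountExchangeFlat; testable, not on the closes path): ∀ε,η>0 ∃ℓ₀ ∀ℓ≥ℓ₀ ∀ᶠn ∃δ ∀ periodic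
δ-near-minimisers, for every ordered pair of distinct cells j ≠ j′ the P̂-mass (weighted by the
midpoint P̂(m+e_j+e_j′)) of base points m at which discrete log-concavity along e_j − e_j′ fails by
more than the factor 1+ε, i.e. (1+ε)P̂(m+e_j+e_j′)² < P̂(m+2e_j)P̂(m+2e_j′), is ≤ η. Exact (mass 0)
for v ≡ 0 (multinomial fibres are binomial) and for determinantal moduli (strongly Rayleigh counts,
BorceaBranden2009, arXiv:0707.2340); physically = convexity in particle number of the cell free
energy given its environment (thermodynamic stability at scale ℓ ≫ ξ), violated only in far tails /
at jamming, which carry no mass. With a fibre variance floor it implies CountExchangeFlat through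
the 1-D lemma "a log-concave pmf with variance σ² has ratio-below-κ mass ≤ C/((1−κ)σ)". [difficulty:
open-problem] [BrascampLieb1976, BrascampLiebLebowitz1975, BorceaBranden2009, arXiv:0707.2340,
arXiv:2007.11030]
#9 KineticStructureFloor (support) — KINETIC STRUCTURE FLOOR (the IR input of the engine; provable
now, Lean effort L): for every periodic C¹ trial state Ψ of N bosons on the torus of side L > 0 and
every m ∈ ℤ³, with k = 2π|m|/L, T = ∫_(cell^N)|∇Ψ|² and N·S_N(k) = structureFactorVar of
Ψ·1_(cell^N): N·k ≤ (N S_N(k))^(1/2)·(2√(NT) + Nk), i.e. S_N(k) ≥ k²/(2√(T/N) + k)². Proof: [ρ_k −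
c, A] = i|k|N for ρ_k = Σ_j e^(−ik·x_j), A = Σ_j e^(ik·x_j) k̂·∇_j; ⟨Ψ,[ρ̄,A]Ψ⟩ = ⟨ρ̄*Ψ, AΨ⟩ − ⟨A*Ψ,
ρ̄Ψ⟩ (integration by parts on the torus, C¹ periodic functions), ‖ρ̄*Ψ‖ = ‖ρ̄Ψ‖, ‖AΨ‖ ≤ √(NT), ‖A*Ψ‖
≤ √(NT) + |k|N (Cauchy–Schwarz), then infimum over c. The Onsager–Price / Pitaevskii–Stringari
uncertainty bounds in elementary kinetic form; for near-minimisers T/N ≲ 4πρa gives S(k) ≥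
k²ξ²/2·(1+o(1)) for kξ ≲ 1. [difficulty: M] [PitaevskiiStringari1991, Stringari1995, Wagner1966,
Feynman1954, Puff1965]

TWO-LAYER PLAN. Foreseen glued splits (nothing filed now): CountExchangeFlat ⇐ FibreLogConcaveCounts
→ FibreVarianceFloor (conditional variance of n_c − n_c′
given the other counts ≥ V(ℓ) → ∞ on all but η of the mass; Gaussian level V ≈ 1/(dᵀC⁻¹d) ≳ ρξℓ²,
i.e. no number rigidity at scale ℓ in d = 3)
→ glue (the 1-D discrete log-concave lemma + size-bias bookkeeping); ALTERNATIVE split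
CountExchangeFlat ⇐ TransferJeffreysBound (J_d = E[Δ_dU(1 −
e^(−Δ_dU))] ≤ J uniformly in d, N, with J from KineticStructureFloor at the Gaussian level) → glue
(Markov: P(Δ_dU > t) ≤ J/(t(1−e^(−t)))).
LocalPlacementFlat ⇐ CountScreening (the conditional law given counts is quasi-local: the ratio of
conditional densities at y::Y vs x::Y is a
product of two single-cell insertion/deletion factors up to e^(±o(1)) w.h.p.) → CellInsertion (fixed
cell with ~ρℓ³ particles and frozen exterior:
insertion factor ≥ κ w.h.p., free-volume / local Jastrow estimate) → glue. PeriodicRigidity ⇐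
bounded-v case (fkL2_perronFrobenius package) →
HardCoreConnectivity (dilute component of N hard spheres on the torus connected and energetically
dominant) → glue.

KILL CRITERIA. TypicalLandscape refuted for some admissible v at arbitrarily small ρ (explicit
growth of the log-ratio spread with L on the 3-torus) closes this
route AND BECMeanFieldControl outright (close --reason refuted:TypicalLandscape) — every
positivity/insertion line dies with it. CountExchangeFlat
refuted at all coarse scales (e.g. an integer/parity structure of P̂, or number rigidity of
near-minimiser counts) ⇒ close refuted:CountExchangeFlat
(the count-law mechanism is dead; LocalPlacementFlat alone is not a thesis). LocalPlacementFlat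
refuted ⇒ PIVOT, not close: restate with smoothed
or two-scale counts (the split variable was too coarse). FibreLogConcaveCounts refuted in bulk form
⇒ drop it and keep the TransferJeffreysBound
split (Gaussian domination by local CLT instead of convexity; the card's name survives only in the
thesis). PeriodicRigidity refuted for hard cores
⇒ restate for bounded v and flag the conjunct for ⊤-valued v (shared failure with three routes).
BoundaryTransferWeak refuted ⇒ shared failure of
≥ 10 routes; pivot the downstream chain to the Dirichlet-native LandscapeBound family
(GroundStateRigidity 9072 / OccupationStability 9074) with
Dirichlet count statements (gen-1 texts exist). TypicalLandscape proved elsewhere (any landscape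
route) moots the cruxes here but closes this route too.

NOT DECOMPOSED YET. Deliberately not items: the Jeffreys/Markov step and the 1-D fibre lemma
(layer-2 glue), the fibre variance floor / no-rigidity statement, the
Gaussian (local CLT) description of P̂ with hyperuniform covariance, the linear Puff floor S ≥
k/√(k²+Cρ) for smooth v (m₃ sum rule) which d = 2
would need, the screening estimate behind LocalPlacementFlat, the uniqueness/connectivity package
behind PeriodicRigidity, constants (κ(η) ≈ η²ρℓ³
for v ≡ 0), smoothed versus sharp cells, the Dirichlet and d = 2 versions. They are layer-2 children
once a crux closes or is split.

CHEAPEST FALSIFIER. (a) v ≡ 0 on the torus (admissible): Ψ₀ = L^(−3N/2), counts multinomial(N; M⁻³):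
exchange ratio n_c₁/(n_c+1), placement ratio (n_c+1)/n_c₁,
fibres binomial (exactly log-concave), TypicalLandscape with any C ≥ 0, rigidity by the kinetic gap
(2π/L)², KineticStructureFloor with equality
at T = 0 — all items hold by hand; a refuter should re-derive the bad-mass bound ≤ e^(−cρℓ³)L³ with
constants first. (b) kit, node-hours: classical
Metropolis for the hard-sphere Jastrow proxy Π(1−a/r_ij)²₊ on the 3-torus at ρa³ = 10⁻³, N =
10³–10⁴, cells ℓ = 2ξ, 4ξ: histogram the exchange
ratio P̂(n − e_c₁ + e_c)/P̂(n) (from the empirical fibre pmf of n_c − n_c′ given coarse neighbours)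
and the bulk fibre second differences; bad mass >
10% below κ = e⁻³ at ℓ = 4ξ that GROWS with L kills CountExchangeFlat for the proxy and makes it
implausible for Ψ₀. (c) 1-D consistency (must FAIL
and does): for the Girardeau state S(k) = |k|/2k_F, the transfer spread grows like ½·log(r k_F),
matching c₀(N) ≈ 1.54√N (OneDimensionalHardCore).
Not run this session (kit not in the payload; searchd intermittently down).

NUMBERS. ξ = (8πρa)^(−1/2), ρξ³ = (8π)^(−3/2)(ρa³)^(−1/2); kinetic floor S(k) ≥ k²/(2√t+k)², t ≤
E₀/N(1+o(1)) = 4πρa(1+O(√(ρa³))) = 1/(2ξ²); Gaussian-level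
transfer precision dᵀC⁻¹d ≤ C₀[4t/(πρℓ) + 2√t/(ρℓ²) + π/(3ρℓ³)] = C₀[16a/ℓ + √2/(ρξℓ²) + π/(3ρℓ³)]
(C₀ ≤ (π/2)⁶ the cell form-factor constant),
versus ≈ C/(ρξℓ²) with the true S ≍ kξ/√2; d = 1: (2k_F/πρ)∫(1−cos kr)dk/k ≈ 2·log(r k_F) (Luttinger
K = 1); hyperuniform window variance ~ ρℓ²ξ vs
Poisson ρℓ³ (TorquatoStillinger2003); free-gas large-deviation bad mass ~ e^(−cρℓ³); closes
constants: C ↦ c = e^(−C)/32, rigidity tolerance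
e^(−C)/8, glue C = −½log(κ₁κ₂). Items at open: 13 (target, 4 cruxes, 7 support, assembly).

DEFINITION REQUESTS. None filed: cell counts, the count law, the teleported configuration
(Matrix.vecCons), the kinetic energy and N·S_N(k)
(Literature.MathematicalPhysics.QuantumManyBody.BoseGas.structureFactorVar, densityWave) are written
inline over PeriodicBoseGas /
BoseGasStructureFactor (Sketch.lean rc 0). Provers may introduce `cellCount` / `countLaw` helpers in
Theorems. No cite facts wanted.

Novelty: Searches (2026-08-15; searchd intermittently unavailable rc 75, graph re-rank down,
OpenAlex/S2/arXiv 429): lit search --source zbmath "rigidity hyperuniform point process" (4: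
Ghosh–Lebowitz arXiv:1601.04216 number rigidity in superhomogeneous fields, arXiv:1707.04328),
"discrete log-concave concentration function" (10: Bobkov–Marsiglietti–Melbourne arXiv:2007.11030 =
the 1-D fibre lemma input), "log-concave Bose gas condensation" (0), "Gaussian domination convexity
continuous symmetry breaking without reflection positivity" (0), "structure factor lower bound
kinetic energy many-body inequality" (0); lit search --hybrid "structure factor lower bound kinetic
energy
sum rule uncertainty Bose gas" (12 held books: Lipparini2008 ch. 10 pp. 464–470 has ω² = m₁/m₋₁ ≤
Feynman and the Puff1965 m₃ sum rule with E_kin —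
the linear floor needs v ∈ C²; no kinetic-only floor stated), lit galaxy search "Brascamp-Lieb
inequality" --star all (31 rows: convex geometry,
random matrices, ∇φ/membrane interface models, Bakry–Émery; nothing on Bose gases or count laws);
plus the card's and the five novelty audits' searches
(crossref/zbMATH/arXiv: "log-concave particle number distribution Bose gas" 0, "Brascamp-Lieb
Bose-Einstein condensation" 0, "log-concave number of
points Gibbs point process" 0; SZ2004 / DSZ2010 found as the engine; Bourgade–Erdős–Yau
doi:10.1007/s00220-014-2120-z + Gustavsson 2005 as the one
working instance of log-concave particle law + BL ⇒ rigidity, d = 1 positions); in-tre  [refs: 10.1007/s00220-014-2120-z, 10.1007/s00220-004-1223-3, 10.1007/s00220-010-1117-5, 1601.04216, 1707.04328, 2007.11030, doi:10.1007/s00220-014-2120-z, doi:10.1007/s00220-004-1223-3, doi:10.1007/s00220-010-1117-5, Puff1965, SpencerZirnbauer2004, PenroseOnsager1956, Reatto1969, McMillan1965]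

Barriers (technique_class: count-law-convexity positivity-ratio structure-floor): - technique_class: count-law-convexity positivity-ratio structure-floor
- Literature.Barriers.AtomisticToContinuum.HalfFillingReflectionPositivity: evaded by construction —
no reflection, lattice, particle–hole symmetry or chessboard estimate; Gaussian domination is a
property asked of the COUNT LAW (fibre convexity / local CLT), the precedent being BLL1975/SZ2004
order-by-convexity without RP; the bet is that P̂ is regular enough at the unit scale, which is
testable (FibreLogConcaveCounts, cheapest falsifier (b)).
- Literature.Barriers.AtomisticToContinuum.KineticGapLengthScales: evaded — no Poincaré/kinetic-gap
inequality at scale L is used; the scale-L input is a count-law tail bound (CountExchangeFlat) whose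
infrared integral converges by the kinetic structure floor, and the only gap-type inputs are at
FIXED N (PeriodicRigidity, δ after N) and fixed scale ℓ (LocalPlacementFlat).
- Literature.Barriers.AtomisticToContinuum.PitaevskiiStringariOneDimension: respected and used as a
check — their uncertainty/sum-rule inequalities are the harmless direction here
(KineticStructureFloor is the same technique pointed at a LOWER bound on S); in d = 1 the transfer
integral ∫(1−cos kr)dk/S(k) diverges logarithmically, which is exactly their no-BEC conclusion.
- Literature.Barriers.AtomisticToContinuum.OneDimensionalHardCore: respected — the Girardeau state
is positive and fails CountExchangeFlat (transfer cost ½·log r), consistent with c₀(N) ~ 1.54√N; the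
chain gives nothing in d = 1

History (route lifecycle, newest last):
- 2026-08-16T02:19:15Z · AUTO-CRUX: 1 conjecture-grade item(s) promoted to crux (FibreLogConcaveCounts) — refuter vetting / tiering apply (operator:999:1362873)
- 2026-08-24T23:47:45Z · DORMANT — reconciler: no traction for 7.2 d (last activity item-evidence-added at 2026-08-17T18:55:01Z); parked, not closed — `ledger route dormant route-AtomisticToConti (operator:999:1435896)
- 2026-08-29T03:14:11Z · REACTIVATED — reconciler: reactivated — activity statement-checked at 2026-08-29T01:17:37Z after parking at 2026-08-24T23:47:45Z (operator:999:3371729)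

sub-problem: BoseEinsteinCondensation · status: open · opened planner-plancard-AtomisticToContinuum-BoseEin-b85a4d9d-g2-0 2026-08-15T19:04:48Z · rev 1 · ledger route-AtomisticToContinuum-BECCountConvexity
GENERATED by the gate from the ledger (D-0016/17). Provers cite these decls: `theorem foo : Summit.AtomisticToContinuum.BoseEinsteinCondensation.Theses.BECCountConvexity.<Decl> := …` in Summits/AtomisticToContinuum/BoseEinsteinCondensation/Theorems/<Name>.lean.
-/

namespace Summit.AtomisticToContinuum.BoseEinsteinCondensation.Theses.BECCountConvexity

open scoped BigOperators Topology Manifold Classical MeasureTheory ProbabilityTheory Matrix InnerProductSpace ComplexConjugate ContinuousMap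
open Filter Set Function TopologicalSpace MeasureTheory

attribute [summit_statement] _root_.BoseEinsteinCondensation

/-- item stmt-AtomisticToContinuum-8701 · target · rank 0 · open · by planner
why it might fail: Conjecture-strength, nothing in print. At Jastrow–Bogoliubov level the one-atom log-increment has N-uniform variance O(√(ρa³)) in d=3, so failure needs beyond-Jastrow lower tails of Ψ₀ (collective/three-body structure) with spread growing in L, as in d=1 (½·log L, Girardeau); no theorem excludes it.
sources: PenroseOnsager1956, ReattoChester1967, McMillan1965, LSSY2005, Lenard1964
[crux] (card K1/K2 in surviving form) for every repulsive finite-range v there is ρ₀ > 0 such that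
for 0 < ρ < ρ₀ there is C ∈ ℝ with: for all large n and every δ > 0 there is a periodic trial state
Ψ of N = n+1 bosons on the torus of side L = (N/ρ)^(1/3), δ-near-minimiser of the periodic energy, Ψ
≥ 0 pointwise, whose exceptional set B = {(x,Y,y) : y ∈ cell, Ψ(y,Y) < e^(−C)Ψ(x,Y)} has
∫_(cell^n)∫_(cell) Ψ(x,Y)²·vol(B_(x,Y)) dx dY ≤ L³/2 (relocating a typical boson to a uniform random
point costs ≤ C in log-amplitude with probability ≥ 1/2). [difficulty: open-problem] -/
@[route_item "route-AtomisticToContinuum-BECCountConvexity"]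
def TypicalLandscape : Prop :=
  ∀ v : ℝ → ENNReal, Literature.MathematicalPhysics.QuantumManyBody.BoseGas.IsRepulsiveFiniteRange v → ∃ ρ₀ : ℝ, 0 < ρ₀ ∧ ∀ ρ : ℝ, 0 < ρ → ρ < ρ₀ → ∃ C : ℝ, ∀ᶠ n : ℕ in Filter.atTop, ∀ δ : ENNReal, 0 < δ → ∃ Ψ : Literature.MathematicalPhysics.QuantumManyBody.BoseGas.PeriodicTrialState (n + 1) (Literature.MathematicalPhysics.QuantumManyBody.BoseGas.sideLength ρ (n + 1)), Literature.MathematicalPhysics.QuantumManyBody.BoseGas.periodicEnergy v Ψ ≤ Literature.MathematicalPhysics.QuantumManyBody.BoseGas.periodicGroundStateEnergy v (n + 1) (Literature.MathematicalPhysics.QuantumManyBody.BoseGas.sideLength ρ (n + 1)) + δ ∧ (∀ X, Ψ.ψ X = (‖Ψ.ψ X‖ : ℂ)) ∧ ∫⁻ Y in Literature.MathematicalPhysics.QuantumManyBody.BoseGas.cellN n (Literature.MathematicalPhysics.QuantumManyBody.BoseGas.sideLength ρ (n + 1)), ∫⁻ x in Literature.MathematicalPhysics.QuantumManyBody.BoseGas.cell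 (Literature.MathematicalPhysics.QuantumManyBody.BoseGas.sideLength ρ (n + 1)), (‖Ψ.ψ (Matrix.vecCons x Y)‖₊ : ENNReal) ^ 2 * MeasureTheory.volume {y : Literature.MathematicalPhysics.QuantumManyBody.BoseGas.Space | y ∈ Literature.MathematicalPhysics.QuantumManyBody.BoseGas.cell (Literature.MathematicalPhysics.QuantumManyBody.BoseGas.sideLength ρ (n + 1)) ∧ ‖Ψ.ψ (Matrix.vecCons y Y)‖ < Real.exp (-C) * ‖Ψ.ψ (Matrix.vecCons x Y)‖} ≤ ENNReal.ofReal (Literature.MathematicalPhysics.QuantumManyBody.BoseGas.sideLength ρ (n + 1) ^ 3 / 2)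

/-- item stmt-AtomisticToContinuum-14003 · crux · rank 2 · open · by planner
why it might fail: Needs unit-scale regularity of the coarse count law uniformly in N: Ψ₀² is hyperuniform (S≍k) and number rigidity does occur in d=3 for some hyperuniform laws (Peres–Sly Thm 1.3; Ghosh–Lebowitz §4, open for fluids); a rigid or parity-structured fibre n_c−n_c′|rest leaves no κ>0 uniform in N.
sources: arXiv:1409.4490, arXiv:1601.04216, GhoshLebowitz2017, ReattoChester1967, TorquatoStillinger2003, BrascampLiebLebowitz1975
[crux] COUNT-EXCHANGE FLATNESS (card items LC + IR merged into their consequence; torus). Tile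
[0,L)³ into M³ cubes, M = ⌊L/ℓ⌋, n(X) = cell-count vector, P̂(m) = Ψ²-probability of {n = m} on the
fundamental cell. ∀η>0 ∃ρ₀(η) ∀ρ<ρ₀ ∃κ>0 ∃ℓ₀ ∀ℓ≥ℓ₀ ∀ᶠn ∃δ>0 (tolerance before density: at low enough
density for each η), for EVERY periodic δ-near-minimiser Ψ of n+1 bosons (complex allowed; depends
on Ψ only through P̂): the pairs (x::Y, y) with P̂(n(y::Y)) < κ·P̂(n(x::Y)) — one particle moved
from the cell of x to the cell of y, typically ~L apart — or with P̂(n(x::Y)) = 0, have (Ψ²dxdY ⊗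
dy)-mass ≤ ηL³. Engine: Jeffreys identity + Gaussian-level bound J_d ≤ C₀[16a/ℓ + √2/(ρξℓ²) +
π/(3ρℓ³)] from KineticStructureFloor; unit-scale regularity from FibreLogConcaveCounts + a fibre
variance floor. v ≡ 0: multinomial counts, ratio n_c₁/(n_c+1), bad mass e^(−cρℓ³)L³ — holds. [deps:
FibreLogConcaveCounts, KineticStructureFloor] [difficulty: open-problem] -/
@[route_item "route-AtomisticToContinuum-BECCountConvexity", crux]
def CountExchangeFlat : Prop :=
  ∀ v : ℝ → ENNReal, Literature.MathematicalPhysics.QuantumManyBody.BoseGas.IsRepulsiveFiniteRange v → ∀ η : ℝ, 0 < η → ∃ ρ₀ : ℝ, 0 < ρ₀ ∧ ∀ ρ : ℝ, 0 < ρ → ρ < ρ₀ → ∃ κ : ℝ, 0 < κ ∧ ∃ ℓ₀ : ℝ, 0 < ℓ₀ ∧ ∀ ℓ : ℝ, ℓ₀ ≤ ℓ → ∀ᶠ n : ℕ in Filter.atTop, let L : ℝ := Literature.MathematicalPhysics.QuantumManyBody.BoseGas.sideLength ρ (n + 1); let M : ℕ := ⌊L / ℓ⌋₊; let cnt : Literature.MathematicalPhysics.QuantumManyBody.BoseGas.Config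 (n + 1) → (Fin 3 → Fin M) → ℕ := fun X j => ∑ i : Fin (n + 1), (if (∀ k : Fin 3, X i k ∈ Set.Ico (((j k : ℕ) : ℝ) * (L / M)) ((((j k : ℕ) : ℝ) + 1) * (L / M))) then 1 else 0); ∃ δ : ENNReal, 0 < δ ∧ ∀ Ψ : Literature.MathematicalPhysics.QuantumManyBody.BoseGas.PeriodicTrialState (n + 1) L, Literature.MathematicalPhysics.QuantumManyBody.BoseGas.periodicEnergy v Ψ ≤ Literature.MathematicalPhysics.QuantumManyBody.BoseGas.periodicGroundStateEnergy v (n + 1) L + δ → let claw : ((Fin 3 → Fin M) → ℕ) → ENNReal := fun m => ∫⁻ Z in Literature.MathematicalPhysics.QuantumManyBody.BoseGas.cellN (n + 1) L, (if cnt Z = m then (‖Ψ.ψ Z‖₊ : ENNReal) ^ 2 else 0); ∫⁻ Y in Literature.MathematicalPhysics.QuantumManyBody.BoseGas.cellN n L, ∫⁻ x in Literature.MathematicalPhysics.QuantumManyBody.BoseGas.cell L, (‖Ψ.ψ (Matrix.vecCons x Y)‖₊ : ENNReal) ^ 2 * MeasureTheory.volume {y : Literature.MathematicalPhysics.QuantumManyBody.BoseGas.Space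 | y ∈ Literature.MathematicalPhysics.QuantumManyBody.BoseGas.cell L ∧ (claw (cnt (Matrix.vecCons y Y)) < ENNReal.ofReal κ * claw (cnt (Matrix.vecCons x Y)) ∨ claw (cnt (Matrix.vecCons x Y)) = 0)} ≤ ENNReal.ofReal (η * L ^ 3)

/-- item stmt-AtomisticToContinuum-14004 · crux · rank 3 · open · by planner
why it might fail: Target-strength given CountExchangeFlat (LP∧CE ⇒ Flat ⇒ LP, refuter), and its bet can break: conditioning on SHARP cell counts need not screen the collective Reatto–Chester 1/r² tail or three-body/cell-boundary layers, leaving an L-dependent residual drift ⇒ no κ at any fixed ℓ uniformly in N.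
sources: ReattoChester1967, Reatto1969, Widom1963, PenroseOnsager1956, Fournais2020
[crux] LOCAL PLACEMENT FLATNESS (card item LINK; torus): with the same cells, the complementary
factor — the conditional density of the configuration given its count vector,
[Ψ(y::Y)²/P̂(n(y::Y))]/[Ψ(x::Y)²/P̂(n(x::Y))], cross-multiplied — is ≥ κ off mass ≤ ηL³, at SOME
scale ℓ ≥ ℓ₀ for every ℓ₀ (∀η ∃ρ₀(η) ∀ρ<ρ₀ ∀ℓ₀ ∃ℓ≥ℓ₀ ∃κ ∀ᶠn ∃δ ∀ near-minimisers; η before ρ₀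
because for hard cores the excluded volume (4π/3)ρa³·L³, where Ψ(y::Y) = 0, is always exceptional):
a fixed-scale statement uniform in N. Engine: dilute-gas insertion inside a cell (Widom /
Penrose–Onsager free volume; the local Jastrow exponent Σ_j u(x−x_j) has x-independent mean and
variance O(√(ρa³)) at low density) and screening of the 1/r² tail by the conditioning on counts. v ≡
0: ratio (n_c+1)/n_c₁ ≈ 1 — tight. Logically X₂ = X − X₁ given P̂ > 0 a.e., so it is no harder than
X once X₁ holds; its content is that it should be provable by fixed-scale means. [deps:
CountExchangeFlat] [difficulty: XL] -/
@[route_item "route-AtomisticToContinuum-BECCountConvexity", crux]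
def LocalPlacementFlat : Prop :=
  ∀ v : ℝ → ENNReal, Literature.MathematicalPhysics.QuantumManyBody.BoseGas.IsRepulsiveFiniteRange v → ∀ η : ℝ, 0 < η → ∃ ρ₀ : ℝ, 0 < ρ₀ ∧ ∀ ρ : ℝ, 0 < ρ → ρ < ρ₀ → ∀ ℓ₀ : ℝ, 0 < ℓ₀ → ∃ ℓ : ℝ, ℓ₀ ≤ ℓ ∧ ∃ κ : ℝ, 0 < κ ∧ ∀ᶠ n : ℕ in Filter.atTop, let L : ℝ := Literature.MathematicalPhysics.QuantumManyBody.BoseGas.sideLength ρ (n + 1); let M : ℕ := ⌊L / ℓ⌋₊; let cnt : Literature.MathematicalPhysics.QuantumManyBody.BoseGas.Config (n + 1) → (Fin 3 → Fin M) → ℕ := fun X j => ∑ i : Fin (n + 1), (if (∀ k : Fin 3, X i k ∈ Set.Ico (((j k : ℕ) : ℝ) * (L / M)) ((((j k : ℕ) : ℝ) + 1) * (L / M))) then 1 else 0); ∃ δ : ENNReal, 0 < δ ∧ ∀ Ψ : Literature.MathematicalPhysics.QuantumManyBody.BoseGas.PeriodicTrialState (n + 1) L, Literature.MathematicalPhysics.QuantumManyBody.BoseGas.periodicEnergy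 v Ψ ≤ Literature.MathematicalPhysics.QuantumManyBody.BoseGas.periodicGroundStateEnergy v (n + 1) L + δ → let claw : ((Fin 3 → Fin M) → ℕ) → ENNReal := fun m => ∫⁻ Z in Literature.MathematicalPhysics.QuantumManyBody.BoseGas.cellN (n + 1) L, (if cnt Z = m then (‖Ψ.ψ Z‖₊ : ENNReal) ^ 2 else 0); ∫⁻ Y in Literature.MathematicalPhysics.QuantumManyBody.BoseGas.cellN n L, ∫⁻ x in Literature.MathematicalPhysics.QuantumManyBody.BoseGas.cell L, (‖Ψ.ψ (Matrix.vecCons x Y)‖₊ : ENNReal) ^ 2 * MeasureTheory.volume {y : Literature.MathematicalPhysics.QuantumManyBody.BoseGas.Space | y ∈ Literature.MathematicalPhysics.QuantumManyBody.BoseGas.cell L ∧ (‖Ψ.ψ (Matrix.vecCons y Y)‖₊ : ENNReal) ^ 2 * claw (cnt (Matrix.vecCons x Y)) < ENNReal.ofReal κ * (‖Ψ.ψ (Matrix.vecCons x Y)‖₊ : ENNReal) ^ 2 * claw (cnt (Matrix.vecCons y Y))} ≤ ENNReal.ofReal (η * L ^ 3)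

/-- item stmt-AtomisticToContinuum-8958 · crux · rank 4 · open · by planner
why it might fail: Routine only for bounded v (compact resolvent + positivity improving, RS-IV XIII.47); admissible v may be ⊤-valued (hard spheres, ⊤-shells): {V<∞} may disconnect, and uniqueness up to phase at fixed N needs the dilute component to be the strict energy minimiser among components: unproved (BBK2013).
sources: ReedSimonIV1978, BaryshnikovBubenikKahle2013, DiaconisLebeauMichel2010, LSSY2005
[crux] (card item PI4, torus twin of BECPalmLandscape.GroundStateRigidity =
stmt-AtomisticToContinuum-3298) ∀ admissible v ∃ρ₀ ∀ρ<ρ₀ ∀ᶠ N ∀η>0 ∃δ>0: any two periodic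
δ-near-minimisers Ψ, Φ ∈ PeriodicTrialState N L (L = (N/ρ)^{1/3}) satisfy ∫_{cell^N}|Ψ − cΦ|² ≤ η
for some unit complex c (E₀^per < ∞ at low density, compact resolvent of the torus N-body operator,
unique positive ground state by positivity improvement, spectral gap at fixed N; hard cores via
energetic dominance / connectivity of the dilute component of configuration space). [difficulty: M] -/
@[route_item "route-AtomisticToContinuum-BECCountConvexity", crux]
def PeriodicRigidity : Prop :=
  ∀ v : ℝ → ENNReal, Literature.MathematicalPhysics.QuantumManyBody.BoseGas.IsRepulsiveFiniteRange v → ∃ ρ₀ : ℝ, 0 < ρ₀ ∧ ∀ ρ : ℝ, 0 < ρ → ρ < ρ₀ → ∀ᶠ N : ℕ in Filter.atTop, ∀ η : ℝ, 0 < η → ∃ δ : ENNReal, 0 < δ ∧ ∀ Ψ Φ : Literature.MathematicalPhysics.QuantumManyBody.BoseGas.PeriodicTrialState N (Literature.MathematicalPhysics.QuantumManyBody.BoseGas.sideLength ρ N), Literature.MathematicalPhysics.QuantumManyBody.BoseGas.periodicEnergy v Ψ ≤ Literature.MathematicalPhysics.QuantumManyBody.BoseGas.periodicGroundStateEnergy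 v N (Literature.MathematicalPhysics.QuantumManyBody.BoseGas.sideLength ρ N) + δ → Literature.MathematicalPhysics.QuantumManyBody.BoseGas.periodicEnergy v Φ ≤ Literature.MathematicalPhysics.QuantumManyBody.BoseGas.periodicGroundStateEnergy v N (Literature.MathematicalPhysics.QuantumManyBody.BoseGas.sideLength ρ N) + δ → ∃ c : ℂ, ‖c‖ = 1 ∧ ∫⁻ X in Literature.MathematicalPhysics.QuantumManyBody.BoseGas.cellN N (Literature.MathematicalPhysics.QuantumManyBody.BoseGas.sideLength ρ N), (‖Ψ.ψ X - c * Φ.ψ X‖₊ : ENNReal) ^ 2 ≤ ENNReal.ofReal η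

/-- item stmt-AtomisticToContinuum-0827 · crux · rank 5 · open · by planner
why it might fail: hypothesis is ground-state-only (δ after N) at box (N/ρ)^(1/3): the Dirichlet state restricted to sub-boxes is neither periodic nor a near-minimiser, so the transfer may be as hard as the conjunct; free-gas BEC is BC-sensitive (Robinson1976).
sources: LSSY2005, Robinson1976, Basti2022, BoccatoSeiringer2023, Junge2026, LauwersVerbeureZagrebnov2003
[crux] BoundaryTransferWeak (mode-free boundary-condition transfer, per potential): for each
repulsive finite-range v, PeriodicBEC(v) implies ∃ρ₀>0 ∀ρ∈(0,ρ₀) HasGroundStateBEC v ρ (Dirichlet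
ground state, λ_max(γ) ≥ cN via condensateNumber). Not glue: near-minimiser slacks are O(N/L²) while
Dirichlet/periodic energies differ by a boundary term ≫ N/L², so no energy-comparison proof;
expected route: Neumann bracketing of interior sub-boxes (−Δ_Dir ≥ ⊕−Δ_Neu, v ≥ 0) + a mode-free
criterion (λ_max ≥ tr γ²/N). Only the ENERGY analogue is in print (LiebSeiringerSolovejYngvason2005
Ch. 2 after (2.8)). v ≡ 0: hypothesis and conclusion both true. -/
@[route_item "route-AtomisticToContinuum-BECCountConvexity", crux]
def BoundaryTransferWeak : Prop :=
  ∀ v : ℝ → ENNReal, Literature.MathematicalPhysics.QuantumManyBody.BoseGas.IsRepulsiveFiniteRange v → (∃ ρ₀ : ℝ, 0 < ρ₀ ∧ ∀ ρ : ℝ, 0 < ρ → ρ < ρ₀ → ∃ c : ℝ, 0 < c ∧ ∀ᶠ N : ℕ in Filter.atTop, ∃ δ : ENNReal, 0 < δ ∧ ∀ Ψ : Literature.MathematicalPhysics.QuantumManyBody.BoseGas.PeriodicTrialState N (Literature.MathematicalPhysics.QuantumManyBody.BoseGas.sideLength ρ N), Literature.MathematicalPhysics.QuantumManyBody.BoseGas.periodicEnergy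 v Ψ ≤ Literature.MathematicalPhysics.QuantumManyBody.BoseGas.periodicGroundStateEnergy v N (Literature.MathematicalPhysics.QuantumManyBody.BoseGas.sideLength ρ N) + δ → ENNReal.ofReal (c * N) ≤ Literature.MathematicalPhysics.QuantumManyBody.BoseGas.condensateOccupation N (Literature.MathematicalPhysics.QuantumManyBody.BoseGas.sideLength ρ N) Ψ.ψ) → ∃ ρ₀ : ℝ, 0 < ρ₀ ∧ ∀ ρ : ℝ, 0 < ρ → ρ < ρ₀ → Literature.MathematicalPhysics.QuantumManyBody.BoseGas.HasGroundStateBEC v ρ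

/-- item stmt-AtomisticToContinuum-14007 · crux (kind.auto-crux: conjecture-grade) · rank 9 · open · by planner
why it might fail: auto-crux — conjecture-grade statement (docstring avows it ('conjecture')); it is open, so it may simply be false
sources: BrascampLieb1976, BrascampLiebLebowitz1975, BorceaBranden2009, arXiv:0707.2340, arXiv:2007.11030
[support] the card's headline conjecture LC in BULK fibre form (engine of CountExchangeFlat;
testable, not on the closes path): ∀ε,η>0 ∃ℓ₀ ∀ℓ≥ℓ₀ ∀ᶠn ∃δ ∀ periodic δ-near-minimisers, for every
ordered pair of distinct cells j ≠ j′ the P̂-mass (weighted by the midpoint P̂(m+e_j+e_j′)) of base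
points m at which discrete log-concavity along e_j − e_j′ fails by more than the factor 1+ε, i.e.
(1+ε)P̂(m+e_j+e_j′)² < P̂(m+2e_j)P̂(m+2e_j′), is ≤ η. Exact (mass 0) for v ≡ 0 (multinomial fibres
are binomial) and for determinantal moduli (strongly Rayleigh counts, BorceaBranden2009,
arXiv:0707.2340); physically = convexity in particle number of the cell free energy given its
environment (thermodynamic stability at scale ℓ ≫ ξ), violated only in far tails / at jamming, which
carry no mass. With a fibre variance floor it implies CountExchangeFlat through the 1-D lemma "a
log-concave pmf with variance σ² has ratio-below-κ mass ≤ C/((1−κ)σ)". [difficulty: open-problem] -/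
@[route_item "route-AtomisticToContinuum-BECCountConvexity"]
def FibreLogConcaveCounts : Prop :=
  ∀ v : ℝ → ENNReal, Literature.MathematicalPhysics.QuantumManyBody.BoseGas.IsRepulsiveFiniteRange v → ∃ ρ₀ : ℝ, 0 < ρ₀ ∧ ∀ ρ : ℝ, 0 < ρ → ρ < ρ₀ → ∀ ε η : ℝ, 0 < ε → 0 < η → ∃ ℓ₀ : ℝ, 0 < ℓ₀ ∧ ∀ ℓ : ℝ, ℓ₀ ≤ ℓ → ∀ᶠ n : ℕ in Filter.atTop, let L : ℝ := Literature.MathematicalPhysics.QuantumManyBody.BoseGas.sideLength ρ (n + 1); let M : ℕ := ⌊L / ℓ⌋₊; let cnt : Literature.MathematicalPhysics.QuantumManyBody.BoseGas.Config (n + 1) → (Fin 3 → Fin M) → ℕ := fun X j => ∑ i : Fin (n + 1), (if (∀ k : Fin 3, X i k ∈ Set.Ico (((j k : ℕ) : ℝ) * (L / M)) ((((j k : ℕ) : ℝ) + 1) * (L / M))) then 1 else 0); ∃ δ : ENNReal, 0 < δ ∧ ∀ Ψ : Literature.MathematicalPhysics.QuantumManyBody.BoseGas.PeriodicTrialState (n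 + 1) L, Literature.MathematicalPhysics.QuantumManyBody.BoseGas.periodicEnergy v Ψ ≤ Literature.MathematicalPhysics.QuantumManyBody.BoseGas.periodicGroundStateEnergy v (n + 1) L + δ → let claw : ((Fin 3 → Fin M) → ℕ) → ENNReal := fun m => ∫⁻ Z in Literature.MathematicalPhysics.QuantumManyBody.BoseGas.cellN (n + 1) L, (if cnt Z = m then (‖Ψ.ψ Z‖₊ : ENNReal) ^ 2 else 0); ∀ j j' : Fin 3 → Fin M, j ≠ j' → ∑' m : (Fin 3 → Fin M) → ℕ, (if ENNReal.ofReal (1 + ε) * claw (m + Pi.single j 1 + Pi.single j' 1) ^ 2 < claw (m + Pi.single j 2) * claw (m + Pi.single j' 2) then claw (m + Pi.single j 1 + Pi.single j' 1) else 0) ≤ ENNReal.ofReal η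

/-- item stmt-AtomisticToContinuum-14005 · support · rank 9 · open · by planner
sources: LSSY2005, PenroseOnsager1956
[support] GLUE of the split (provable now): CountExchangeFlat → LocalPlacementFlat →
PositivePeriodicNearMinimiser → PeriodicEnergyFinite → TypicalLandscape (the two support hypotheses
are inlined verbatim in the Lean term so the decl is independent of the gate's rendering order).
Pointwise in y: off bad_CE ∪ bad_LP one has κ₁P̂(n) ≤ P̂(n′), 0 < P̂(n) ≤ 1 and κ₂Ψ²P̂(n′) ≤
Ψ′²P̂(n), hence κ₁κ₂Ψ(x::Y)² ≤ Ψ(y::Y)² (ENNReal.mul_le_mul_right), i.e. y ∉ bad_T with e^(−C) =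
√(κ₁κ₂); volumes are monotone and subadditive, the weights Ψ(x::Y)² integrate by lintegral_add_left
once (x,Y) ↦ vol(bad_CE) is shown measurable (cnt takes countably many values on measurable boxes);
quantifiers: η = 1/4 twice (fixing ρ₀^CE, ρ₀^LP), ρ₀ = min(ρ₀^CE, ρ₀^LP, ρ₀^F), κ₁ and ℓ₀ from CE, ℓ
≥ ℓ₀ and κ₂ from LP, CE at that ℓ, C = −log(κ₁κ₂)/2, eventual ranges intersected (shift N = n+1), δ′
= min(δ, δ_CE, δ_LP) and the witness from PositivePeriodicNearMinimiser (E₀^per ≠ ⊤ by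
PeriodicEnergyFinite). [difficulty: provable-now] -/
@[route_item "route-AtomisticToContinuum-BECCountConvexity", crux]
def CountLocalSplit : Prop :=
  CountExchangeFlat → LocalPlacementFlat → (∀ (v : ℝ → ENNReal) (N : ℕ) (L : ℝ), Literature.MathematicalPhysics.QuantumManyBody.BoseGas.periodicGroundStateEnergy v N L ≠ ⊤ → ∀ δ : ENNReal, 0 < δ → ∃ Φ : Literature.MathematicalPhysics.QuantumManyBody.BoseGas.PeriodicTrialState N L, Literature.MathematicalPhysics.QuantumManyBody.BoseGas.periodicEnergy v Φ ≤ Literature.MathematicalPhysics.QuantumManyBody.BoseGas.periodicGroundStateEnergy v N L + δ ∧ ∀ X, Φ.ψ X = (‖Φ.ψ X‖ : ℂ)) → (∀ v : ℝ → ENNReal, Literature.MathematicalPhysics.QuantumManyBody.BoseGas.IsRepulsiveFiniteRange v → ∃ ρ₀ : ℝ, 0 < ρ₀ ∧ ∀ ρ : ℝ, 0 < ρ → ρ < ρ₀ → ∀ᶠ N : ℕ in Filter.atTop, Literature.MathematicalPhysics.QuantumManyBody.BoseGas.periodicGroundStateEnergy v N (Literature.MathematicalPhysics.QuantumManyBody.BoseGas.sideLength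 ρ N) ≠ ⊤) → TypicalLandscape

/-- item stmt-AtomisticToContinuum-14006 · support · rank 9 · open · by planner
sources: LSSY2005, ReedSimonIV1978
[support] periodic twin of BECRieszLandscape.PositiveNearMinimiserExists: whenever E₀^per(N, L) < ⊤,
for every δ > 0 there is a δ-near-minimiser Φ ∈ PeriodicTrialState N L with Φ = ‖Φ‖ pointwise.
Construction without mollifiers: from a δ/2-near-minimiser Ψ put Φ_ε := (√(|Ψ|² + ε²) − ε)/‖·‖₂ — C¹
(|Ψ|² is C¹, t ↦ √(t+ε²) smooth), periodic, symmetric, vanishes exactly where Ψ does (cores: ⊤·0 =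
0), |∇Φ_ε| ≤ |∇Ψ|/‖·‖ and Φ_ε ≤ |Ψ|/‖·‖ pointwise, ‖√(|Ψ|²+ε²) − ε‖₂ → 1; so periodicEnergy Φ_ε ≤ E₀
+ δ for small ε. N = 0: the constant state. [difficulty: provable-now] -/
@[route_item "route-AtomisticToContinuum-BECCountConvexity", crux]
def PositivePeriodicNearMinimiser : Prop :=
  ∀ (v : ℝ → ENNReal) (N : ℕ) (L : ℝ), Literature.MathematicalPhysics.QuantumManyBody.BoseGas.periodicGroundStateEnergy v N L ≠ ⊤ → ∀ δ : ENNReal, 0 < δ → ∃ Φ : Literature.MathematicalPhysics.QuantumManyBody.BoseGas.PeriodicTrialState N L, Literature.MathematicalPhysics.QuantumManyBody.BoseGas.periodicEnergy v Φ ≤ Literature.MathematicalPhysics.QuantumManyBody.BoseGas.periodicGroundStateEnergy v N L + δ ∧ ∀ X, Φ.ψ X = (‖Φ.ψ X‖ : ℂ)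

/-- item stmt-AtomisticToContinuum-14008 · support · rank 9 · open · by planner
sources: PitaevskiiStringari1991, Stringari1995, Wagner1966, Feynman1954, Puff1965
[support] KINETIC STRUCTURE FLOOR (the IR input of the engine; provable now, Lean effort L): for
every periodic C¹ trial state Ψ of N bosons on the torus of side L > 0 and every m ∈ ℤ³, with k =
2π|m|/L, T = ∫_(cell^N)|∇Ψ|² and N·S_N(k) = structureFactorVar of Ψ·1_(cell^N): N·k ≤ (N
S_N(k))^(1/2)·(2√(NT) + Nk), i.e. S_N(k) ≥ k²/(2√(T/N) + k)². Proof: [ρ_k − c, A] = i|k|N for ρ_k =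
Σ_j e^(−ik·x_j), A = Σ_j e^(ik·x_j) k̂·∇_j; ⟨Ψ,[ρ̄,A]Ψ⟩ = ⟨ρ̄*Ψ, AΨ⟩ − ⟨A*Ψ, ρ̄Ψ⟩ (integration by
parts on the torus, C¹ periodic functions), ‖ρ̄*Ψ‖ = ‖ρ̄Ψ‖, ‖AΨ‖ ≤ √(NT), ‖A*Ψ‖ ≤ √(NT) + |k|N
(Cauchy–Schwarz), then infimum over c. The Onsager–Price / Pitaevskii–Stringari uncertainty bounds
in elementary kinetic form; for near-minimisers T/N ≲ 4πρa gives S(k) ≥ k²ξ²/2·(1+o(1)) for kξ ≲ 1.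
[difficulty: M] -/
@[route_item "route-AtomisticToContinuum-BECCountConvexity"]
def KineticStructureFloor : Prop :=
  ∀ (N : ℕ) (L : ℝ), 0 < L → ∀ (Ψ : Literature.MathematicalPhysics.QuantumManyBody.BoseGas.PeriodicTrialState N L) (m : Fin 3 → ℤ), let k : ℝ := 2 * Real.pi / L * Real.sqrt (∑ t : Fin 3, ((m t : ℤ) : ℝ) ^ 2); let T : ENNReal := ∫⁻ X in Literature.MathematicalPhysics.QuantumManyBody.BoseGas.cellN N L, Literature.MathematicalPhysics.QuantumManyBody.BoseGas.kineticDensity Ψ.ψ X; (N : ENNReal) * ENNReal.ofReal k ≤ (Literature.MathematicalPhysics.QuantumManyBody.BoseGas.structureFactorVar N L ((Literature.MathematicalPhysics.QuantumManyBody.BoseGas.cellN N L).indicator Ψ.ψ) m) ^ (1 / 2 : ℝ) * (2 * ((N : ENNReal) * T) ^ (1 / 2 : ℝ) + (N : ENNReal) * ENNReal.ofReal k)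

/-- item stmt-AtomisticToContinuum-3974 · support · rank 9 · closed · proved by Summit.AtomisticToContinuum.BoseEinsteinCondensation.Theorems.periodicEnergyFinite_proof (prover) · by planner
sources: LSSY2005
[support] FINITENESS: for repulsive finite-range v (range R₀) there is ρ₀ > 0 with E₀^per(N,
(N/ρ)^{1/3}) < ⊤ for ρ < ρ₀ and all large N (N bumps at mutual torus distance > R₀; or directly from
LSSY2005_upperBound_periodic_holds once scatteringLength v ≠ ⊤, cf. stmt-AtomisticToContinuum-0851).
Needed to subtract in ℝ≥0∞ and to make the near-minimiser hypotheses non-vacuous. [difficulty: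
provable-now] -/
@[route_item "route-AtomisticToContinuum-BECCountConvexity", crux]
def PeriodicEnergyFinite : Prop :=
  ∀ v : ℝ → ENNReal, Literature.MathematicalPhysics.QuantumManyBody.BoseGas.IsRepulsiveFiniteRange v → ∃ ρ₀ : ℝ, 0 < ρ₀ ∧ ∀ ρ : ℝ, 0 < ρ → ρ < ρ₀ → ∀ᶠ N : ℕ in Filter.atTop, Literature.MathematicalPhysics.QuantumManyBody.BoseGas.periodicGroundStateEnergy v N (Literature.MathematicalPhysics.QuantumManyBody.BoseGas.sideLength ρ N) ≠ ⊤

/-- `PeriodicEnergyFinite` holds: proved by `Summit.AtomisticToContinuum.BoseEinsteinCondensation.Theorems.periodicEnergyFinite_proof`. -/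
theorem PeriodicEnergyFinite_holds : PeriodicEnergyFinite := _root_.Summit.AtomisticToContinuum.BoseEinsteinCondensation.Theorems.periodicEnergyFinite_proof

/-- item stmt-AtomisticToContinuum-8703 · support · rank 9 · closed · proved by Summit.AtomisticToContinuum.BoseEinsteinCondensation.Theorems.landscapeToCondensate_proof @ 98044d30c319 (prover) · by planner
sources: PenroseOnsager1956, LSSY2005
[support] (card P1, periodic, one-sided) for L > 0, any real C and any periodic trial state Ψ ≥ 0 of
n+1 bosons on the torus of side L: if ∫_(cell^n)∫_(cell) Ψ(x,Y)²·vol{y ∈ cell : Ψ(y,Y) <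
e^(−C)Ψ(x,Y)} dx dY ≤ L³/2 then condensateOccupation ≥ (n+1)e^(−C)/2 (occ₀ = (n+1)L⁻³∫s(Y)²dY with s
= ∫_cell Ψ(·,Y); s² = ∫∫Ψ(x,Y)Ψ(y,Y) ≥ e^(−C)∫Ψ(x,Y)²·vol(good_(x,Y)); ∫∫Ψ² = 1 via the
measure-preserving split X = x :: Y of the cell). [difficulty: provable-now] -/
@[route_item "route-AtomisticToContinuum-BECCountConvexity", crux]
def LandscapeToCondensate : Prop :=
  ∀ (n : ℕ) (L C : ℝ), 0 < L → ∀ Ψ : Literature.MathematicalPhysics.QuantumManyBody.BoseGas.PeriodicTrialState (n + 1) L, (∀ X, Ψ.ψ X = (‖Ψ.ψ X‖ : ℂ)) → ∫⁻ Y in Literature.MathematicalPhysics.QuantumManyBody.BoseGas.cellN n L, ∫⁻ x in Literature.MathematicalPhysics.QuantumManyBody.BoseGas.cell L, (‖Ψ.ψ (Matrix.vecCons x Y)‖₊ : ENNReal) ^ 2 * MeasureTheory.volume {y : Literature.MathematicalPhysics.QuantumManyBody.BoseGas.Space | y ∈ Literature.MathematicalPhysics.QuantumManyBody.BoseGas.cell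 L ∧ ‖Ψ.ψ (Matrix.vecCons y Y)‖ < Real.exp (-C) * ‖Ψ.ψ (Matrix.vecCons x Y)‖} ≤ ENNReal.ofReal (L ^ 3 / 2) → ENNReal.ofReal ((n + 1) * Real.exp (-C) / 2) ≤ Literature.MathematicalPhysics.QuantumManyBody.BoseGas.condensateOccupation (n + 1) L Ψ.ψ

/-- `LandscapeToCondensate` holds: proved by `Summit.AtomisticToContinuum.BoseEinsteinCondensation.Theorems.landscapeToCondensate_proof` @ 98044d30c319. -/
theorem LandscapeToCondensate_holds : LandscapeToCondensate := _root_.Summit.AtomisticToContinuum.BoseEinsteinCondensation.Theorems.landscapeToCondensate_proof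

/-- item stmt-AtomisticToContinuum-9164 · support · rank 9 · closed · proved by Summit.AtomisticToContinuum.BoseEinsteinCondensation.Theorems.periodicOccupationStability_proof (prover) · by planner
sources: LSSY2005
[support] OCCUPATION STABILITY on the torus: for periodic trial states Ψ, Φ of N bosons and |c| = 1,
condensateOccupation(Ψ)^(1/2) ≤ condensateOccupation(Φ)^(1/2) + N^(1/2) (∫_(cell^N)|Ψ − cΦ|²)^(1/2)
(F_Ψ(Y) = ⟨φ₀, Ψ(·,Y)1_cell⟩, |F_Ψ − F_(cΦ)| ≤ ‖(Ψ − cΦ)(·,Y)‖_(L²(cell)), Minkowski in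
L²(cell^(N−1)); occ(cΦ) = occ(Φ)). [difficulty: provable-now] -/
@[route_item "route-AtomisticToContinuum-BECCountConvexity", crux]
def PeriodicOccupationStability : Prop :=
  ∀ (N : ℕ) (L : ℝ), 0 < L → ∀ (Ψ Φ : Literature.MathematicalPhysics.QuantumManyBody.BoseGas.PeriodicTrialState N L) (c : ℂ), ‖c‖ = 1 → Literature.MathematicalPhysics.QuantumManyBody.BoseGas.condensateOccupation N L Ψ.ψ ^ (1 / 2 : ℝ) ≤ Literature.MathematicalPhysics.QuantumManyBody.BoseGas.condensateOccupation N L Φ.ψ ^ (1 / 2 : ℝ) + (N : ENNReal) ^ (1 / 2 : ℝ) * (∫⁻ X in Literature.MathematicalPhysics.QuantumManyBody.BoseGas.cellN N L, (‖Ψ.ψ X - c * Φ.ψ X‖₊ : ENNReal) ^ 2) ^ (1 / 2 : ℝ)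

/-- `PeriodicOccupationStability` holds: proved by `Summit.AtomisticToContinuum.BoseEinsteinCondensation.Theorems.periodicOccupationStability_proof`. -/
theorem PeriodicOccupationStability_holds : PeriodicOccupationStability := _root_.Summit.AtomisticToContinuum.BoseEinsteinCondensation.Theorems.periodicOccupationStability_proof

/-- item stmt-AtomisticToContinuum-14009 · assembly · rank 1 · open · by planner
sources: LSSY2005, PenroseOnsager1956
[assembly] CountExchangeFlat → LocalPlacementFlat → PositivePeriodicNearMinimiser →
PeriodicEnergyFinite → CountLocalSplit → PeriodicRigidity → LandscapeToCondensate →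
PeriodicOccupationStability → BoundaryTransferWeak → BoseEinsteinCondensation (the sub-problem
Statement, _root_; = the type of `closes`). -/
@[route_item "route-AtomisticToContinuum-BECCountConvexity"]
def Assembly : Prop :=
  CountExchangeFlat → LocalPlacementFlat → PositivePeriodicNearMinimiser → PeriodicEnergyFinite → CountLocalSplit → PeriodicRigidity → LandscapeToCondensate → PeriodicOccupationStability → BoundaryTransferWeak → _root_.BoseEinsteinCondensation

/-! D-0027 §2.1 — DECIDING THEOREM (planner-authored via `route open/edit --closes-file`; by planner-plancard-AtomisticToContinuum-BoseEin-b85a4d9d-g2-0 2026-08-15T19:04:49Z):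
its hypotheses are this route's items and its conclusion the sub-problem Statement (glue_lint), and it elaborates with this file. -/

@[closes "route-AtomisticToContinuum-BECCountConvexity"] theorem closes (hCE : CountExchangeFlat) (hLP : LocalPlacementFlat) (hP : PositivePeriodicNearMinimiser)
    (hF : PeriodicEnergyFinite) (hS : CountLocalSplit) (h₂ : PeriodicRigidity) (h₃ : LandscapeToCondensate)
    (h₄ : PeriodicOccupationStability) (h₅ : BoundaryTransferWeak) :
    _root_.BoseEinsteinCondensation := by
  -- the count-law split delivers the shared hinge TypicalLandscape (stmt-AtomisticToContinuum-8701)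
  have h₁ : TypicalLandscape := hS hCE hLP hP hF
  -- from here: the certified chain of route BECMeanFieldControl (TypicalLandscape, PeriodicRigidity,
  -- LandscapeToCondensate, PeriodicOccupationStability, BoundaryTransferWeak ⊢ BoseEinsteinCondensation)
  intro v hv
  apply h₅ v hv
  obtain ⟨ρ₁, hρ₁, hTL⟩ := h₁ v hv
  obtain ⟨ρ₂, hρ₂, hPR⟩ := h₂ v hv
  refine ⟨min ρ₁ ρ₂, lt_min hρ₁ hρ₂, fun ρ hρ hρlt => ?_⟩
  obtain ⟨C, hC⟩ := hTL ρ hρ (lt_of_lt_of_le hρlt (min_le_left _ _))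
  have hR := hPR ρ hρ (lt_of_lt_of_le hρlt (min_le_right _ _))
  refine ⟨Real.exp (-C) / 32, by positivity, ?_⟩
  rw [Filter.eventually_atTop] at hC hR ⊢
  obtain ⟨n₀, hn₀⟩ := hC
  obtain ⟨N₀, hN₀⟩ := hR
  refine ⟨n₀ + N₀ + 1, fun N hN => ?_⟩
  obtain ⟨n, rfl⟩ : ∃ n, N = n + 1 := ⟨N - 1, by omega⟩
  have hn : n₀ ≤ n := by omega
  have hNN : N₀ ≤ n + 1 := by omega
  -- positivity of the side length
  have hLpos : 0 < Literature.MathematicalPhysics.QuantumManyBody.BoseGas.sideLength ρ (n + 1) := by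
    unfold Literature.MathematicalPhysics.QuantumManyBody.BoseGas.sideLength
    apply Real.rpow_pos_of_pos
    positivity
  -- rigidity at tolerance η = e^{-C}/8 fixes δ
  obtain ⟨δ, hδ, hrig⟩ := hN₀ (n + 1) hNN (Real.exp (-C) / 8) (by positivity)
  refine ⟨δ, hδ, fun Φ hΦ => ?_⟩
  -- the landscape state at this δ
  obtain ⟨Ψ, hΨE, hΨnn, hΨexc⟩ := hn₀ n hn δ hδ
  have hocc := h₃ n _ C hLpos Ψ hΨnn hΨexc
  obtain ⟨c, hc, hclose⟩ := hrig Ψ Φ hΨE hΦ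
  have hstab := h₄ (n + 1) _ hLpos Ψ Φ c hc
  -- abbreviations
  set A := Literature.MathematicalPhysics.QuantumManyBody.BoseGas.condensateOccupation (n + 1)
    (Literature.MathematicalPhysics.QuantumManyBody.BoseGas.sideLength ρ (n + 1)) Ψ.ψ with hA
  set B := Literature.MathematicalPhysics.QuantumManyBody.BoseGas.condensateOccupation (n + 1)
    (Literature.MathematicalPhysics.QuantumManyBody.BoseGas.sideLength ρ (n + 1)) Φ.ψ with hB
  set I := ∫⁻ X in Literature.MathematicalPhysics.QuantumManyBody.BoseGas.cellN (n + 1)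
    (Literature.MathematicalPhysics.QuantumManyBody.BoseGas.sideLength ρ (n + 1)),
      (‖Ψ.ψ X - c * Φ.ψ X‖₊ : ENNReal) ^ 2 with hI
  -- real bookkeeping
  set m : ℝ := (n : ℝ) + 1 with hm
  have hm0 : 0 ≤ m := by positivity
  have hcast : ((n + 1 : ℕ) : ℝ) = m := by push_cast; rfl
  have hcastE : ((n + 1 : ℕ) : ENNReal) = ENNReal.ofReal m := by
    rw [← hcast, ENNReal.ofReal_natCast]
  set e : ℝ := Real.exp (-C) with he
  have he0 : 0 < e := Real.exp_pos _
  set a : ℝ := Real.sqrt (m * e / 2) with ha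
  set b : ℝ := Real.sqrt (m * e / 8) with hb
  have ha0 : 0 ≤ a := Real.sqrt_nonneg _
  have hb0 : 0 ≤ b := Real.sqrt_nonneg _
  have hab : a = 2 * b := by
    have h4 : Real.sqrt 4 = 2 := by
      rw [show (4 : ℝ) = 2 ^ 2 by norm_num, Real.sqrt_sq (by norm_num : (0 : ℝ) ≤ 2)]
    rw [ha, hb, show m * e / 2 = 4 * (m * e / 8) by ring, Real.sqrt_mul (by norm_num : (0:ℝ) ≤ 4), h4]
  have hbsq : b ^ 2 = m * e / 8 := by
    rw [hb, Real.sq_sqrt (by positivity)]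
  -- step 1: ofReal a ≤ A^(1/2)
  have h1 : ENNReal.ofReal a ≤ A ^ (1 / 2 : ℝ) := by
    have : ENNReal.ofReal (m * e / 2) ≤ A := by
      have := hocc
      simpa [hm, he, mul_comm, mul_left_comm, mul_assoc, mul_div_assoc] using this
    calc ENNReal.ofReal a = ENNReal.ofReal ((m * e / 2) ^ (1 / 2 : ℝ)) := by
            rw [ha, Real.sqrt_eq_rpow]
      _ = (ENNReal.ofReal (m * e / 2)) ^ (1 / 2 : ℝ) :=
            (ENNReal.ofReal_rpow_of_nonneg (by positivity) (by norm_num)).symm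
      _ ≤ A ^ (1 / 2 : ℝ) := ENNReal.rpow_le_rpow this (by norm_num)
  -- step 2: the error term is ≤ ofReal b
  have h2 : ((n + 1 : ℕ) : ENNReal) ^ (1 / 2 : ℝ) * I ^ (1 / 2 : ℝ) ≤ ENNReal.ofReal b := by
    have hI' : I ^ (1 / 2 : ℝ) ≤ (ENNReal.ofReal (e / 8)) ^ (1 / 2 : ℝ) :=
      ENNReal.rpow_le_rpow hclose (by norm_num)
    calc ((n + 1 : ℕ) : ENNReal) ^ (1 / 2 : ℝ) * I ^ (1 / 2 : ℝ)
        ≤ ((n + 1 : ℕ) : ENNReal) ^ (1 / 2 : ℝ) * (ENNReal.ofReal (e / 8)) ^ (1 / 2 : ℝ) :=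
          mul_le_mul' le_rfl hI'
      _ = ENNReal.ofReal (m ^ (1 / 2 : ℝ)) * ENNReal.ofReal ((e / 8) ^ (1 / 2 : ℝ)) := by
          rw [hcastE, ENNReal.ofReal_rpow_of_nonneg hm0 (by norm_num),
            ENNReal.ofReal_rpow_of_nonneg (by positivity) (by norm_num)]
      _ = ENNReal.ofReal (m ^ (1 / 2 : ℝ) * (e / 8) ^ (1 / 2 : ℝ)) :=
          (ENNReal.ofReal_mul (Real.rpow_nonneg hm0 _)).symm
      _ = ENNReal.ofReal b := by
          rw [← Real.mul_rpow hm0 (by positivity), hb, Real.sqrt_eq_rpow]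
          congr 1
          ring_nf
  -- step 3: ofReal (a - b) ≤ B^(1/2)
  have h3 : ENNReal.ofReal (a - b) ≤ B ^ (1 / 2 : ℝ) := by
    have hle : ENNReal.ofReal a ≤ B ^ (1 / 2 : ℝ) + ENNReal.ofReal b :=
      h1.trans (hstab.trans (add_le_add le_rfl h2))
    rw [ENNReal.ofReal_sub a hb0]
    exact tsub_le_iff_right.mpr hle
  -- step 4: square
  have h4 : ENNReal.ofReal ((a - b) ^ 2) ≤ B := by
    have hsq := ENNReal.rpow_le_rpow h3 (by norm_num : (0 : ℝ) ≤ 2)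
    rw [← ENNReal.rpow_mul, show (1 / 2 : ℝ) * 2 = 1 by norm_num, ENNReal.rpow_one,
      ENNReal.ofReal_rpow_of_nonneg (by rw [hab]; linarith) (by norm_num), Real.rpow_two] at hsq
    exact hsq
  -- step 5: compare constants
  calc ENNReal.ofReal (Real.exp (-C) / 32 * ((n + 1 : ℕ) : ℝ))
      ≤ ENNReal.ofReal ((a - b) ^ 2) := by
        apply ENNReal.ofReal_le_ofReal
        rw [hcast, hab, show (2 * b - b) ^ 2 = b ^ 2 by ring, hbsq, ← he]
        nlinarith [he0, hm0]
    _ ≤ B := h4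

end Summit.AtomisticToContinuum.BoseEinsteinCondensation.Theses.BECCountConvexity
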